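import Summits.ABC.IUTFork.Conditional.RefBandsInhCeilLevelsCells99794037551104
import Summits.ABC.IUTFork.Cor312LicenceTripleLocalTypeCeil
import Summits.ABC.IUTFork.Cor312GenuineKWildExactTriple
import Summits.ABC.IUTFork.Conditional.AbcOfSGenuineKTameRobustRows5
import HarnessLib

/-!
# R-W «OPEN-SINGLE-PRIMES»: the `223`-triple `99794037551104 + 3¹⁵·11³·97⁵·409 = 5¹⁵·179⁴·2141` (`a = 2¹²·13³·223³`) — S_H INHABITED at EVERY genuine Θ-volume datum at the reading-caveat levels `l ∈ {6133}`, UNCONDITIONAL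

PROOF-ONLY file (D-0012: 0 definitions, 0 `Prop` facts, no instance, no notation) of the abc-iut cell — D-0079 RESCUE sub-cell R-W «WINDOW Θ-SIDE
INEQUALITY», seat abc-iut-W-neg-1 (gen 5), row «OPEN-SINGLE-PRIMES» (abc-iut-plan C-R105 (a)). abc-iut-W-num-6's `RefBandsInhBand99794037551104` (integer-slot socket) covers
every prime `l` from its uniform threshold up; its exact-level addenda cover the primes below it where the integer slot still decides; the levels here are
the ones where ONLY the reading of the inner radius decides (top-label cell at `n = 1` over `97`: fails under `⌊e/96⌋`, holds under `⌈e/96⌉`).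
CONTENT: for `l ∈ {6133}` and EVERY genuine Θ-volume datum `T : ThetaVolumeDatumAt (ratPoint (a/c)) l` of this triple, with NO hypothesis on
the local type: abc-iut-c312-1's `Thm311ToCor312.Licence` HOLDS at abc-iut-c312-7's `settingPrVolSharp (pilotDataOfK T.D T.K) …` for every pair of
realising Θ- and q-ideles (`WRow.licence_triple_99794037551104_ceil_levels`), hence branch C's antecedent «∃ ρ qK, QPinned ∧ PilotKummerCompatHull»
(`WRow.exists_qPinned_and_hull_triple_99794037551104_ceil_levels`) — this seat's CEILING-slot socket `WRow.licence_triple_unconditional_ceil` (inner radius `⌈e/(p−1)⌉`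
by `WRow.inner_witness_ceil`, p511165; otherwise W-row-1's slot socket verbatim) at `RefBand.inhcell_99794037551104_ceil_levels`. READING (neutral): these levels
are INHABITED AS TYPED; the socket's `ρin` is a free binder with a witness obligation, so the ceiling is the TYPE's reading, not a choice. HONEST SCOPE:
inhabited-AS-TYPED over OUR objects; admissibility / non-emptiness of the datum type NOT claimed; nothing about the number-level `Cor22.Cor312AtDatum`
or the printed inequality; typed ≠ proved; no side taken on [IUTchIII] Cor. 3.12; no abc claim.
-/

noncomputable section

open Set Function Metric NumberField IsDedekindDomain

namespace Summit.ABC.IUTFork.Conditional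

open Thm311 Thm311.Real Cor312 Cor312Vol Cor312Prov Literature.IUT.LogThetaLattice Literature.IUT.LogVolume
  Literature.IUT.HodgeTheaters Literature.IUT.LogVolume.Cor22
open Literature.NumberTheory.NumberFields Literature.NumberTheory.GaloisRepresentations.Ultrametric
open Literature.NumberTheory.DiophantineGeometry Literature.NumberTheory.DiophantineGeometry.GenEll

/-- **INHABITED AT THE READING-CAVEAT LEVELS (unconditional in the local type): `2 ^ 12 * 13 ^ 3 * 223 ^ 3 + 3 ^ 15 * 11 ^ 3 * 97 ^ 5 * 409 = 5 ^ 15 * 179 ^ 4 * 2141`, `l ∈ {6133}`, EVERY genuine Θ-volume datum, every pair of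
realising Θ- and q-ideles ⇒ `Thm311ToCor312.Licence (settingPrVolSharp (pilotDataOfK T.D T.K) …)`** — this seat's CEILING-slot socket `WRow.licence_triple_ceil_of_localType` (hooked: the wild exact type at `5`)
(inner radius `⌈e/(p−1)⌉`, `WRow.inner_witness_ceil`) at `RefBand.inhcell_99794037551104_ceil_levels` (envelope exponents `if p = 3 then 7 else if p = 5 then 7 else if p = 11 then 1 else if p = 13 then 1 else if p = 97 then 2 else if p = 179 then 1 else if p = 223 then 1 else if p = 409 then 0 else if p = 2141 then 0 else 0`, both entries; binding prime `97`:
the top-label cell at `n = 1` holds under the ceiling and fails under the integer slot). [cite: Mochizuki2012, IUTchI Def. 3.1 (b),(c) pp. 61–62, Ex. 3.2 (iv) p. 71; IUTchIII Cor. 3.12 Step (xi-f) p. 184; IUTchIV Prop. 1.1 p. 9, Prop. 1.2 (i)(ii) p. 10, Cor. 2.2 (ii) proof (P5) p. 46]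
[cite: DupuyHilado2025, §3.3, §3.4, §4.9, §4.12] [claim: Mochizuki2012, status: disputed] -/
theorem WRow.licence_triple_99794037551104_ceil_levels {l : ℕ} (hlv : l = 6133)
    (T : Cor22.ThetaVolumeDatumAt (ratPoint (((2 ^ 12 * 13 ^ 3 * 223 ^ 3 : ℕ) : ℚ) / (5 ^ 15 * 179 ^ 4 * 2141 : ℕ))) l) :
    letI := T.instFieldF; letI := T.instNumberFieldF; letI := T.instAlgebraF; letI := T.instFieldK
    letI := T.instNumberFieldK; letI := T.instAlgebraK; letI := T.instFieldFbar; letI := T.instAlgebraFbar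
    letI := T.instAlgebraKFbar; letI := T.instIsElliptic
    ∀ {logv : PadicLogs T.K} (hlog : LogvAnalytic logv) (M : Type) [Field M] [NumberField M]
      (archPk : ∀ (j : (thetaIndex (pilotDataOfK T.D T.K)).Label) (vQ : (thetaIndex (pilotDataOfK T.D T.K)).VQ),
        Set ((logShellsDH (pilotDataOfK T.D T.K) logv).Packet j vQ))
      (archSub : ∀ (j : (thetaIndex (pilotDataOfK T.D T.K)).Label) (v : (thetaIndex (pilotDataOfK T.D T.K)).V),
        Set ((logShellsDH (pilotDataOfK T.D T.K) logv).Packet j ((thetaIndex (pilotDataOfK T.D T.K)).over v)))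
      (Ψ : ℤ → ∀ v : (thetaIndex (pilotDataOfK T.D T.K)).V, v ∈ (thetaIndex (pilotDataOfK T.D T.K)).Vbad →
        Set ((logShellsDH (pilotDataOfK T.D T.K) logv).StarPacket v))
      (act : ℤ → ∀ v : (thetaIndex (pilotDataOfK T.D T.K)).V, v ∈ (thetaIndex (pilotDataOfK T.D T.K)).Vbad →
        (logShellsDH (pilotDataOfK T.D T.K) logv).StarPacket v → Module.End ℚ ((logShellsDH (pilotDataOfK T.D T.K) logv).StarPacket v))
      (Mmod : ℤ → ∀ j : (thetaIndex (pilotDataOfK T.D T.K)).LabelStar, Set ((logShellsDH (pilotDataOfK T.D T.K) logv).GlobalPacket j.1))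
      (region : ℤ → ∀ j : (thetaIndex (pilotDataOfK T.D T.K)).LabelStar, FinDivisor M → ∀ vQ : (thetaIndex (pilotDataOfK T.D T.K)).VQ,
        Set ((logShellsDH (pilotDataOfK T.D T.K) logv).Packet j.1 vQ))
      (n : ℤ) {HT : Type} {LogLink : HT → HT → Type} {IsFull : ∀ {s t : HT}, LogLink s t → Prop}
      (lat : LGPGaussianLogThetaLattice LogLink IsFull)
      {Frd : Type} {IsoF : Frd → Frd → Type} {Ob : Frd → Type} {realify : Frd → Frd} {Strip : Type}
      {IsoS : Strip → Strip → Type} {Mv : ∀ v : (thetaIndex (pilotDataOfK T.D T.K)).V, v ∈ (thetaIndex (pilotDataOfK T.D T.K)).Vbad → Type}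
      [∀ v h, Monoid (Mv v h)]
      (sig : GlobalLGPFrobenioidSignature (thetaIndex (pilotDataOfK T.D T.K)).lstar (thetaIndex (pilotDataOfK T.D T.K)).V
        (· ∈ (thetaIndex (pilotDataOfK T.D T.K)).Vbad) Frd IsoF Ob realify Strip IsoS Mv)
      (split : SplittingMonoids Mv) {ObΔ : Type} {N : ∀ v : (thetaIndex (pilotDataOfK T.D T.K)).V, v ∈ (thetaIndex (pilotDataOfK T.D T.K)).Vbad → Type}
      [∀ v h, Monoid (N v h)] (qData : QPilotData ObΔ N)
      (tq : ∀ (pp : Nat.Primes) (x : (thetaIndex (pilotDataOfK T.D T.K)).Fibre (.inr pp)),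
        haveI : Fact (pp : ℕ).Prime := ⟨pp.2⟩; kOf (pilotDataOfK T.D T.K) pp.1 x)
      (t : ∀ (pp : Nat.Primes) (_ : Fin (pilotDataOfK T.D T.K).lstar) (x : (thetaIndex (pilotDataOfK T.D T.K)).Fibre (.inr pp)),
        haveI : Fact (pp : ℕ).Prime := ⟨pp.2⟩; kOf (pilotDataOfK T.D T.K) pp.1 x)
      (htq0 : ∀ pp x, tq pp x ≠ 0)
      (htq1 : ∀ (pp : Nat.Primes) (x : (thetaIndex (pilotDataOfK T.D T.K)).Fibre (.inr pp)),
        haveI : Fact (pp : ℕ).Prime := ⟨pp.2⟩; placeOf (pilotDataOfK T.D T.K) pp.1 x ∉ (pilotDataOfK T.D T.K).S → ‖tq pp x‖ = 1)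
      (_ht0 : ∀ pp i x, t pp i x ≠ 0)
      (_ht : ∀ (pp : Nat.Primes) (i : Fin (pilotDataOfK T.D T.K).lstar) (x : (thetaIndex (pilotDataOfK T.D T.K)).Fibre (.inr pp)),
        haveI : Fact (pp : ℕ).Prime := ⟨pp.2⟩
        Real.log ‖t pp i x‖ = -((pilotDataOfK T.D T.K).thetaPilot i (placeOf (pilotDataOfK T.D T.K) pp.1 x)) *
          logNorm T.K (placeOf (pilotDataOfK T.D T.K) pp.1 x) / localDegree T.K (placeOf (pilotDataOfK T.D T.K) pp.1 x))
      (_htq : ∀ (pp : Nat.Primes) (x : (thetaIndex (pilotDataOfK T.D T.K)).Fibre (.inr pp)),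
        haveI : Fact (pp : ℕ).Prime := ⟨pp.2⟩
        Real.log ‖tq pp x‖ = -((pilotDataOfK T.D T.K).qPilot (placeOf (pilotDataOfK T.D T.K) pp.1 x)) *
          logNorm T.K (placeOf (pilotDataOfK T.D T.K) pp.1 x) / localDegree T.K (placeOf (pilotDataOfK T.D T.K) pp.1 x)),
      Thm311ToCor312.Licence
        (settingPrVolSharp (pilotDataOfK T.D T.K) hlog M archPk archSub Ψ act Mmod region n lat sig split qData tq t htq0 htq1) :=
  WRow.licence_triple_ceil_of_localType isABCTriple_frey99794037551104 (by rw [Cor22.jInv_ratPoint_triple isABCTriple_frey99794037551104]; norm_num) T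
    (fun p => if p = 3 then 7 else if p = 5 then 7 else if p = 11 then 1 else if p = 13 then 1 else if p = 97 then 2 else if p = 179 then 1 else if p = 223 then 1 else if p = 409 then 0 else if p = 2141 then 0 else 0) (fun p => if p = 3 then 7 else if p = 5 then 7 else if p = 11 then 1 else if p = 13 then 1 else if p = 97 then 2 else if p = 179 then 1 else if p = 223 then 1 else if p = 409 then 0 else if p = 2141 then 0 else 0) (fun p e => (5 = p → e = 20 * l))
    (by
      intro pp x _ hpp
      obtain rfl : pp = ⟨5, by norm_num⟩ := Subtype.ext hpp.symm
      have h := GenuineK.absRamificationIdx_kOf_eq_wildUnit_of_triple (p' := 3) (v := 15) isABCTriple_frey99794037551104 T ⟨5, by norm_num⟩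
        (Or.inr ⟨rfl, rfl⟩) (by simp; omega) (by norm_num) (by norm_num) (by norm_num) (by norm_num) (by norm_num) (by norm_num)
      rw [h x]; norm_num) (RefBand.inhcell_99794037551104_ceil_levels (by subst hlv; norm_num) hlv)

/-- **BRANCH C's PER-DATUM ANTECEDENT «∃ ρ qK, QPinned ∧ PilotKummerCompatHull» INHABITED at every genuine datum of `2 ^ 12 * 13 ^ 3 * 223 ^ 3 + 3 ^ 15 * 11 ^ 3 * 97 ^ 5 * 409 = 5 ^ 15 * 179 ^ 4 * 2141` at the levels `l ∈ {6133}`**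
(any columns `col`; every pair of realising Θ- and q-ideles, the CHOSEN ones of the window certificates' `hSHw`/`hSHwBad` binders included) — abc-iut-w5-d009's
`exists_qPinned_and_hull_settingPrVolSharp_iff_licence` over `WRow.licence_triple_99794037551104_ceil_levels` (ceiling inner slot).
[cite: Mochizuki2012, IUTchIII Cor. 3.12 Step (xi-d) p. 183, (xi-f) p. 184] [cite: DupuyHilado2025, §3.3, §3.4, §4.9] [claim: Mochizuki2012, status: disputed] -/
theorem WRow.exists_qPinned_and_hull_triple_99794037551104_ceil_levels {l : ℕ} (hlv : l = 6133)
    (T : Cor22.ThetaVolumeDatumAt (ratPoint (((2 ^ 12 * 13 ^ 3 * 223 ^ 3 : ℕ) : ℚ) / (5 ^ 15 * 179 ^ 4 * 2141 : ℕ))) l) :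
    letI := T.instFieldF; letI := T.instNumberFieldF; letI := T.instAlgebraF; letI := T.instFieldK
    letI := T.instNumberFieldK; letI := T.instAlgebraK; letI := T.instFieldFbar; letI := T.instAlgebraFbar
    letI := T.instAlgebraKFbar; letI := T.instIsElliptic
    ∀ {logv : PadicLogs T.K} (hlog : LogvAnalytic logv) (M : Type) [Field M] [NumberField M]
      (archPk : ∀ (j : (thetaIndex (pilotDataOfK T.D T.K)).Label) (vQ : (thetaIndex (pilotDataOfK T.D T.K)).VQ),
        Set ((logShellsDH (pilotDataOfK T.D T.K) logv).Packet j vQ))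
      (archSub : ∀ (j : (thetaIndex (pilotDataOfK T.D T.K)).Label) (v : (thetaIndex (pilotDataOfK T.D T.K)).V),
        Set ((logShellsDH (pilotDataOfK T.D T.K) logv).Packet j ((thetaIndex (pilotDataOfK T.D T.K)).over v)))
      (Ψ : ℤ → ∀ v : (thetaIndex (pilotDataOfK T.D T.K)).V, v ∈ (thetaIndex (pilotDataOfK T.D T.K)).Vbad →
        Set ((logShellsDH (pilotDataOfK T.D T.K) logv).StarPacket v))
      (act : ℤ → ∀ v : (thetaIndex (pilotDataOfK T.D T.K)).V, v ∈ (thetaIndex (pilotDataOfK T.D T.K)).Vbad →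
        (logShellsDH (pilotDataOfK T.D T.K) logv).StarPacket v → Module.End ℚ ((logShellsDH (pilotDataOfK T.D T.K) logv).StarPacket v))
      (Mmod : ℤ → ∀ j : (thetaIndex (pilotDataOfK T.D T.K)).LabelStar, Set ((logShellsDH (pilotDataOfK T.D T.K) logv).GlobalPacket j.1))
      (region : ℤ → ∀ j : (thetaIndex (pilotDataOfK T.D T.K)).LabelStar, FinDivisor M → ∀ vQ : (thetaIndex (pilotDataOfK T.D T.K)).VQ,
        Set ((logShellsDH (pilotDataOfK T.D T.K) logv).Packet j.1 vQ))
      (n : ℤ) {HT : Type} {LogLink : HT → HT → Type} {IsFull : ∀ {s t : HT}, LogLink s t → Prop}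
      (lat : LGPGaussianLogThetaLattice LogLink IsFull)
      {Frd : Type} {IsoF : Frd → Frd → Type} {Ob : Frd → Type} {realify : Frd → Frd} {Strip : Type}
      {IsoS : Strip → Strip → Type} {Mv : ∀ v : (thetaIndex (pilotDataOfK T.D T.K)).V, v ∈ (thetaIndex (pilotDataOfK T.D T.K)).Vbad → Type}
      [∀ v h, Monoid (Mv v h)]
      (sig : GlobalLGPFrobenioidSignature (thetaIndex (pilotDataOfK T.D T.K)).lstar (thetaIndex (pilotDataOfK T.D T.K)).V
        (· ∈ (thetaIndex (pilotDataOfK T.D T.K)).Vbad) Frd IsoF Ob realify Strip IsoS Mv)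
      (split : SplittingMonoids Mv) {ObΔ : Type} {N : ∀ v : (thetaIndex (pilotDataOfK T.D T.K)).V, v ∈ (thetaIndex (pilotDataOfK T.D T.K)).Vbad → Type}
      [∀ v h, Monoid (N v h)] (qData : QPilotData ObΔ N)
      (tq : ∀ (pp : Nat.Primes) (x : (thetaIndex (pilotDataOfK T.D T.K)).Fibre (.inr pp)),
        haveI : Fact (pp : ℕ).Prime := ⟨pp.2⟩; kOf (pilotDataOfK T.D T.K) pp.1 x)
      (t : ∀ (pp : Nat.Primes) (_ : Fin (pilotDataOfK T.D T.K).lstar) (x : (thetaIndex (pilotDataOfK T.D T.K)).Fibre (.inr pp)),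
        haveI : Fact (pp : ℕ).Prime := ⟨pp.2⟩; kOf (pilotDataOfK T.D T.K) pp.1 x)
      (htq0 : ∀ pp x, tq pp x ≠ 0)
      (htq1 : ∀ (pp : Nat.Primes) (x : (thetaIndex (pilotDataOfK T.D T.K)).Fibre (.inr pp)),
        haveI : Fact (pp : ℕ).Prime := ⟨pp.2⟩; placeOf (pilotDataOfK T.D T.K) pp.1 x ∉ (pilotDataOfK T.D T.K).S → ‖tq pp x‖ = 1)
      (col : ℤ → Column (logShellsDH (pilotDataOfK T.D T.K) logv))
      (_ht0 : ∀ pp i x, t pp i x ≠ 0)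
      (_ht : ∀ (pp : Nat.Primes) (i : Fin (pilotDataOfK T.D T.K).lstar) (x : (thetaIndex (pilotDataOfK T.D T.K)).Fibre (.inr pp)),
        haveI : Fact (pp : ℕ).Prime := ⟨pp.2⟩
        Real.log ‖t pp i x‖ = -((pilotDataOfK T.D T.K).thetaPilot i (placeOf (pilotDataOfK T.D T.K) pp.1 x)) *
          logNorm T.K (placeOf (pilotDataOfK T.D T.K) pp.1 x) / localDegree T.K (placeOf (pilotDataOfK T.D T.K) pp.1 x))
      (_htq : ∀ (pp : Nat.Primes) (x : (thetaIndex (pilotDataOfK T.D T.K)).Fibre (.inr pp)),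
        haveI : Fact (pp : ℕ).Prime := ⟨pp.2⟩
        Real.log ‖tq pp x‖ = -((pilotDataOfK T.D T.K).qPilot (placeOf (pilotDataOfK T.D T.K) pp.1 x)) *
          logNorm T.K (placeOf (pilotDataOfK T.D T.K) pp.1 x) / localDegree T.K (placeOf (pilotDataOfK T.D T.K) pp.1 x)),
      ∃ (ρ : (∀ v : (thetaIndex (pilotDataOfK T.D T.K)).V, v ∈ (thetaIndex (pilotDataOfK T.D T.K)).Vbad →
              Set ((logShellsDH (pilotDataOfK T.D T.K) logv).StarPacket v)) →
            ∀ (j : (thetaIndex (pilotDataOfK T.D T.K)).Label) (vQ : (thetaIndex (pilotDataOfK T.D T.K)).VQ),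
              Set ((logShellsDH (pilotDataOfK T.D T.K) logv).Packet j vQ))
          (qK : ∀ v : (thetaIndex (pilotDataOfK T.D T.K)).V, v ∈ (thetaIndex (pilotDataOfK T.D T.K)).Vbad →
            Set ((logShellsDH (pilotDataOfK T.D T.K) logv).StarPacket v)),
          QPinned ({ toSituation := situationPrVol (pilotDataOfK T.D T.K) hlog M archPk archSub Ψ act Mmod region, col := col } :
              LatticeSituation (thetaIndex (pilotDataOfK T.D T.K)))
            (settingPrVolSharp (pilotDataOfK T.D T.K) hlog M archPk archSub Ψ act Mmod region n lat sig split qData tq t htq0 htq1) ρ qK ∧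
          PilotKummerCompatHull ({ toSituation := situationPrVol (pilotDataOfK T.D T.K) hlog M archPk archSub Ψ act Mmod region, col := col } :
              LatticeSituation (thetaIndex (pilotDataOfK T.D T.K)))
            (settingPrVolSharp (pilotDataOfK T.D T.K) hlog M archPk archSub Ψ act Mmod region n lat sig split qData tq t htq0 htq1) ρ qK :=
  WRow.exists_qPinned_and_hull_triple_ceil_of_localType isABCTriple_frey99794037551104 (by rw [Cor22.jInv_ratPoint_triple isABCTriple_frey99794037551104]; norm_num) T
    (fun p => if p = 3 then 7 else if p = 5 then 7 else if p = 11 then 1 else if p = 13 then 1 else if p = 97 then 2 else if p = 179 then 1 else if p = 223 then 1 else if p = 409 then 0 else if p = 2141 then 0 else 0) (fun p => if p = 3 then 7 else if p = 5 then 7 else if p = 11 then 1 else if p = 13 then 1 else if p = 97 then 2 else if p = 179 then 1 else if p = 223 then 1 else if p = 409 then 0 else if p = 2141 then 0 else 0) (fun p e => (5 = p → e = 20 * l))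
    (by
      intro pp x _ hpp
      obtain rfl : pp = ⟨5, by norm_num⟩ := Subtype.ext hpp.symm
      have h := GenuineK.absRamificationIdx_kOf_eq_wildUnit_of_triple (p' := 3) (v := 15) isABCTriple_frey99794037551104 T ⟨5, by norm_num⟩
        (Or.inr ⟨rfl, rfl⟩) (by simp; omega) (by norm_num) (by norm_num) (by norm_num) (by norm_num) (by norm_num) (by norm_num)
      rw [h x]; norm_num) (RefBand.inhcell_99794037551104_ceil_levels (by subst hlv; norm_num) hlv)

end Summit.ABC.IUTFork.Conditional

end
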